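import Summits.QuantumFields.YangMills.Theorems.BalabanLadderIRRankPurityDefs
import HarnessLib

/-!
# Crux `IRcof` (stmt-QuantumFields-26930) — SUPPLIER LINE «lipschitz-vacuum-transport» (cell ym-gapexp, idea ymfull-r2c-lens-4 g0;
# crux-plan bytes `Cruxes/IRcof/Lines/lipschitz_vacuum_transport.lean` c2701ff81c6bc899, critic ymfull-r2c-crit-1 CUT-3(B2) PASS
# 2026-08-30T22:58Z): VOCABULARY as tree constants (definition lane; nothing is claimed)

Helper module for `Summit.QuantumFields.YangMills.Theses.BalabanLadder.IRcof` (stmt-QuantumFields-26930; `--supports`, it closes nothing),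
landed by the crux LEAD (ymfull-r2c-lead-1 g1, `Cruxes/IRcof/PICKED.md`): the slot of record stays `Cruxes/IRcof/Lines/pinned_cofinal_bill.lean`
d3255819134117aa {`stub_pinnedExitsCofinal : PinnedExitsCofinalAt (1/24)`, `stub_irnscCof : IRnscCof`}, and the line «lipschitz-vacuum-transport»
is booked as a SUPPLIER of the first stub: its statement LW-DOM (`LevelwiseDominatedCofinal`, STRONGER than PXcof(1∕24)) implies
`RunningLandmark.PinnedExitsCofinalAt (1/24)` by a kernel-clean argument (free-tower smallness + spectral bookkeeping), proved in the sibling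
modules `LevelwiseDominationTower` ∕ `LevelwiseDominationKernel`.  For those proofs to live under `Theorems/` the five route-posited objects of
the line must be tree constants; they are made so here, bodies BYTE-IDENTICAL to the critic-certified bytes (c2701ff8 §0 = lens-4 sheet v2.3):
the lattice dispersion `ω_{m,c}(k)`, the occupation energy of a free-boson configuration, the free massive tower's thermal trace excess
`gaussTowerExcess`, the level-matching predicate `LevelMatched` (injective domination of a ratio datum `IsRatioDatum` by the tower), and the
line statement `LevelwiseDominatedCofinal` itself (a `def … : Prop`, a HYPOTHESIS of the cut — not a literature fact, not a claim).

WHY LW-DOM MIGHT FAIL ∕ status of its roadmap (card `Cruxes/IRcof/Lines/lipschitz_vacuum_transport.md`; LEAD obstruction `PICKED.md` §2):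
the carded mechanism (K) «uniform log-concavity of the Coulomb-chart Wilson × Faddeev–Popov measure on Zwanziger's region» is false as a GLOBAL
statement for β ≳ 1 (large-field log-convexity of the Wilson weight; classical modulus 0 on the toron valley), so LW-DOM currently carries no
mechanism beyond PXcof; (DT) the discrete-time Doob dictionary is idea-needed.  The definitions below are nevertheless the currency in which
the instrument (ROSE, `LevelMatched` toys at L = 1) and any future supplier proof are stated.

HONEST FRAMING: supplier-line bookkeeping for a CONDITIONAL reduction of the junior binder `IRcof` (the infinite-volume rung R2c of a
conditional chain); `LevelwiseDominatedCofinal` is an OPEN, width-0 line statement (it contains the volume-uniform lattice mass gap); nothing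
here proves it, `PinnedExitsCofinalAt (1/24)`, `IRnscCof`, `IRcof`, `IR`, any leg, or the Yang–Mills mass gap (Clay) — NOT proved; NOT
continuum ∕ OS.  R4 closes only the conditional finite-𝕋⁴ rung `BalabanLadder.UV`.
Refs: L. Caffarelli, Comm. Math. Phys. 214 (2000) (contraction); E. Milman, J. Spectral Theory 8 (2018); D. Zwanziger, Nucl. Phys. B 209
(1982); M. Lüscher, Nucl. Phys. B 219 (1983); P. van Baal–J. Koller, Ann. Phys. 174 (1987).
-/

set_option autoImplicit false

noncomputable section

open Filter Topology MeasureTheory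
open scoped BigOperators
open Literature.MathematicalPhysics.QuantumFieldTheory Literature.MathematicalPhysics.QuantumLattice
open Summit.QuantumFields.YangMills.Cruxes.OSLegsFromFemtoAndGap.DlrCollarTransfer (LowerBounds)
open Summit.QuantumFields.YangMills.Cruxes.IR.RankPurity (IsRatioDatum)

namespace Summit.QuantumFields.YangMills.Cruxes.IR.LevelwiseDomination

/-! ## §0 Vocabulary (route-posited objects of the supplier line «lipschitz-vacuum-transport», bytes of c2701ff81c6bc899) -/

/-- Lattice dispersion `ω_{m,c}(k) = √(m² + c² Σ_j (2 sin(π k_j/L))²)` on the spatial torus `(ℤ/L)³`. -/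
def latticeDispersion (m c : ℝ) (L : ℕ) (k : Fin 3 → Fin L) : ℝ :=
  Real.sqrt (m ^ 2 + c ^ 2 * ∑ j : Fin 3, (2 * Real.sin (Real.pi * ((k j : ℕ) : ℝ) / L)) ^ 2)

/-- Occupation energy of a configuration `g : (species × momentum) → ℕ`. -/
def occupationEnergy (d : ℕ) (m c : ℝ) (L : ℕ) (g : Fin d × (Fin 3 → Fin L) → ℕ) : ℝ :=
  ∑ p : Fin d × (Fin 3 → Fin L), (g p : ℝ) * latticeDispersion m c L p.2

/-- **Free massive tower.** Thermal trace excess of `d` species of free lattice bosons on `L³` at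
Euclidean time `t`: `Π_k (1 − e^{−t ω(k)})^{−d} − 1`. -/
def gaussTowerExcess (d : ℕ) (m c : ℝ) (L t : ℕ) : ℝ :=
  (∏ k : Fin 3 → Fin L, (1 - Real.exp (-((t : ℝ) * latticeDispersion m c L k)))⁻¹) ^ d - 1

/-- **Level matching.** The ratio datum `rr` is injectively dominated by the free tower:
`∃ f : ι ↪ (species × momentum), rr i ≤ e^{−E_ref(f i)}` on the support. -/
def LevelMatched {ι : Type} (rr : ι → ℝ) (d : ℕ) (m c : ℝ) (L : ℕ) : Prop :=
  ∃ f : ι → (Fin d × (Fin 3 → Fin L) → ℕ), Set.InjOn f {i | rr i ≠ 0} ∧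
    ∀ i, rr i ≤ Real.exp (-(occupationEnergy d m c L (f i)))

/-- **LW-DOM `LevelwiseDominatedCofinal` (STRONGER than PXcof(1/24)).**  For s.c. compact simple `G`,
every `r`, every positive unit `a → 0` carrying the floor: ∃ d c μ T₀, for every T ≥ T₀, COFINALLY
in β, some pinned torus `a(β)L ∈ [T, 2T]`, `L ≥ 8`, has its WHOLE transfer-matrix spectrum level-matched
into the free tower of mass `μ·a(β)` with `d` species and speed margin `c`.

MECHANISM: 1-Lipschitz transport from `γ_{M,ω}` to the Doob measure on Zwanziger's convex Coulomb
chart (Caffarelli contraction + E. Milman spectral comparison) + Doob dictionary.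

WHY IT MIGHT FAIL: (K) `−log Ω₊²` not convex relative to the massive Gaussian on the Coulomb chart
off the perturbative region; (DT) discrete-time dictionary needed; U(1): κ_IR = 0; SO(3): multimodal
chart (twisted flat sectors); the free constants d, μ, c, T₀ are existential but NO exposure is
proved. -/
def LevelwiseDominatedCofinal : Prop :=
  ∀ (G : Type) [Group G] [TopologicalSpace G] [IsTopologicalGroup G] [CompactSpace G],
    IsCompactSimpleLieGroup G → SimplyConnectedSpace G →
    letI : MeasurableSpace G := borel G
    haveI : BorelSpace G := ⟨rfl⟩
    ∀ (r : LatticeRep G) (a : ℝ → ℝ), (∀ β, 0 < a β) → Tendsto a atTop (𝓝 0) → LowerBounds G r a →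
      ∃ (d : ℕ) (c μ T₀ : ℝ), 0 < c ∧ 0 < μ ∧ ∀ T : ℝ, T₀ ≤ T → ∀ β₁ : ℝ, ∃ β : ℝ, β₁ ≤ β ∧ 0 ≤ β ∧
        ∃ (L : ℕ) (_ : NeZero L), 8 ≤ L ∧ T ≤ a β * (L : ℝ) ∧ a β * (L : ℝ) ≤ 2 * T ∧
          ∀ (ι : Type) [DecidableEq ι] (rr : ι → ℝ) (i₀ : ι), IsRatioDatum r.ρ β L ι rr i₀ →
            LevelMatched rr d (μ * a β) c L

end Summit.QuantumFields.YangMills.Cruxes.IR.LevelwiseDomination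

end
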